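import Literature.Topology.FourManifolds.BasinRadial
import HarnessLib

/-!
# The basin setting: the cone structure of the level conjugation in the radial chart

Topic `Literature/Topology/FourManifolds`; ninth file of the endgame of the Torelli half of
Griffiths' handlebody theorem.  Everything here is **proved**.

For `B : BasinSetting g ξ` and `χ` preserving the traces:
* `conj_ofChart_smul`, `psi_ofChart_smul` — **the level conjugation commutes with the scalings of
  the chart ball** (inside the ball all trajectories are rays traversed at the same rate, so the
  conjugate of a flowed point is the flowed conjugate);
* `BasinSetting.coneFun χ v = toChart (psi χ (ofChart v))` — the chart expression of `psi` near
  `p₀`: norm-preserving (`norm_coneFun`), homogeneous of degree one for factors in `(0, 1]`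
  (`coneFun_smul`), inverted by `coneFun χ'` (`coneFun_coneFun`), smooth on the punctured open
  ball (`contMDiffAt_coneFun`) — a CONE over a map of the sphere of directions, smooth off the
  apex only.

## References

* J. Milnor, *Lectures on the h-cobordism theorem*, notes by L. Siebenmann and J. Sondow,
  Princeton Mathematical Notes (1965): Def. 3.1, proof of Thm. 3.4 (PDF pp. 11–13), Def. 3.9
  (PDF p. 16), Thm. 4.1 (PDF p. 22), proof of Thm. 5.4, Assertion 4 (PDF p. 29).
  [MilnorHCobordism1965]
* J. Milnor, *Morse theory* (1963), Thm. 3.1 and proof of Thm. 4.1 (p. 25). [Milnor1963]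
* H. B. Griffiths, *Automorphisms of a 3-dimensional handlebody*, Abh. Math. Sem. Univ. Hamburg
  26 (1964), §§3–6. [GriffithsHB1964Handlebody]
-/

open scoped Manifold ContDiff Topology
open Set Function Filter Metric

noncomputable section

namespace Literature.Topology.FourManifolds

open Cobordism FourManifolds.Flow

universe u

variable {n : ℕ} {W : Type u} [TopologicalSpace W] [T2Space W] [SecondCountableTopology W]
  [CompactSpace W] [ChartedSpace (EuclideanHalfSpace (n + 1)) W] [IsManifold (𝓡∂ (n + 1)) ∞ W]

/-! ### The cone structure of `psi` in the radial chart, and the map of the sphere of directions -/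

namespace BasinSetting

variable {g : W → ℝ} {ξ : Π x : W, TangentSpace (𝓡∂ (n + 1)) x} (B : BasinSetting g ξ)
variable [Nonempty (BoundaryManifold.boundaryData n W).carrier]

omit [Nonempty (BoundaryManifold.boundaryData n W).carrier] in
/-- **The domain of the level conjugation is invariant under the flow** inside `{g < hi}`. [folklore] -/
theorem θ_mem_dom_iff {x : W} {t : ℝ} (hx : g x < B.hi) (ht : g (B.θ (t, x)) < B.hi) :
    B.θ (t, x) ∈ B.dom ↔ x ∈ B.dom := by
  constructor
  · rintro ⟨-, hhit, htop⟩
    have hhit' : Hits B.θ g B.L x := B.isSmoothFlow.hits_apply_iff.1 hhit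
    exact ⟨hx, hhit', by rwa [B.top_θ hhit'] at htop⟩
  · rintro ⟨-, hhit, htop⟩
    exact ⟨ht, B.isSmoothFlow.hits_apply_iff.2 hhit, by rwa [B.top_θ hhit]⟩

variable {B}
variable {χ χ' : (𝓡∂ (n + 1)).boundary W → (𝓡∂ (n + 1)).boundary W}

/-- `psi` maps `{g < sph}` into itself (it preserves levels). [folklore] -/
theorem apply_psi_lt_sph (hχ : ∀ y, χ y ∈ B.traces ↔ y ∈ B.traces) {x : W} (hx : g x < B.sph) :
    g (B.psi χ x) < B.sph := by rw [apply_psi hχ]; exact hx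

/-- **The level conjugation commutes with the flow along a basin trajectory inside the chart
ball**: for `x ∈ dom` with `g x < sph` and `log`-time `t ≤ 0`, `conj χ (θ (t, x))` is the point
`θ (t, ·)` of... more precisely it is the point of the trajectory of `conj χ x` at the level of
`θ (t, x)`; inside the chart ball, where all trajectories are rays traversed at the same rate, this
is `ofChart (eᵗ • toChart (conj χ x))`. [cite: MilnorHCobordism1965, Def. 3.1 (2), Thm. 4.1] -/
theorem conj_ofChart_smul (hχ : ∀ y, χ y ∈ B.traces ↔ y ∈ B.traces) {v : EuclideanSpace ℝ (Fin (n + 1))}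
    (hv : ‖v‖ < B.r₀) (hxd : B.ofChart v ∈ B.dom) {s : ℝ} (hs : 0 < s) (hs1 : s ≤ 1) :
    B.conj χ (B.ofChart (s • v)) = B.ofChart (s • B.toChart (B.conj χ (B.ofChart v))) := by
  set x := B.ofChart v with hx
  have hxsph : g x < B.sph := B.apply_ofChart_lt_sph hv
  have htx : B.toChart x = v := B.toChart_ofChart hv.le
  -- the scaled point is a flow point of `x`
  have hxs : B.ofChart (s • v) = B.θ (Real.log s, x) := by rw [← htx]; exact B.ofChart_smul_toChart hxsph hs hs1
  have hsv : ‖s • v‖ < B.r₀ := by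
    rw [norm_smul, Real.norm_eq_abs, abs_of_pos hs]; exact lt_of_le_of_lt (mul_le_of_le_one_left (norm_nonneg v) hs1) hv
  have hxs_sph : g (B.ofChart (s • v)) < B.sph := B.apply_ofChart_lt_sph hsv
  have hxs_hi : g (B.ofChart (s • v)) < B.hi := hxs_sph.trans (B.sph_lt_L.trans B.L_lt_hi)
  have hxsd : B.ofChart (s • v) ∈ B.dom := by rw [hxs] at hxs_hi ⊢; exact (B.θ_mem_dom_iff hxd.1 hxs_hi).2 hxd
  -- the conjugate `y` of `x` and the transported top `w'`
  set w' := B.transport χ (B.top x) with hw'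
  set y := B.conj χ x with hy
  have hw'L : g w' = B.L := B.apply_transport χ _
  have hy_eq : y = B.θ (hittingTime B.θ g (g x) w', w') := rfl
  have hysph : g y < B.sph := by rw [hy, apply_conj hχ hxd]; exact hxsph
  have hty : ‖B.toChart y‖ ^ 2 = g x - g B.p₀ := by rw [B.norm_toChart_sq hysph.le, hy, apply_conj hχ hxd]
  -- the scaled conjugate is a flow point of `w'`
  have hys : B.ofChart (s • B.toChart y) = B.θ (Real.log s + hittingTime B.θ g (g x) w', w') := by
    rw [B.ofChart_smul_toChart hysph hs hs1, hy_eq, B.θ_add]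
  -- its level is that of the scaled point
  have hlev : g (B.ofChart (s • B.toChart y)) = g (B.ofChart (s • v)) := by
    have h1 : ‖s • B.toChart y‖ ≤ B.r₀ := by
      rw [norm_smul, Real.norm_eq_abs, abs_of_pos hs]
      exact (mul_le_of_le_one_left (norm_nonneg _) hs1).trans (B.norm_toChart_le hysph.le)
    rw [B.apply_ofChart h1, B.apply_ofChart hsv.le, norm_smul, norm_smul, mul_pow, mul_pow, hty,
      ← htx, B.norm_toChart_sq hxsph.le]
  -- hence it is the level point of `w'` at that level, i.e. the conjugate of the scaled point
  have htop_s : B.top (B.ofChart (s • v)) = B.top x := by rw [hxs]; exact B.top_θ hxd.2.1 _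
  rw [conj_def, htop_s, ← hw']
  rw [hys] at hlev
  rw [B.levelProj_eq_of_apply_θ_eq hw'L (apply_mem_Ioo_of_mem_dom hxsd) hlev, ← hys]

/-- **`psi` commutes with the scaling of the chart ball**: `psi χ (ofChart (s • v)) =
ofChart (s • toChart (psi χ (ofChart v)))` for `0 < s ≤ 1`, `0 < ‖v‖ < r₀`. [cite: GriffithsHB1964Handlebody, §§3–6] -/
theorem psi_ofChart_smul (hχ : ∀ y, χ y ∈ B.traces ↔ y ∈ B.traces) {v : EuclideanSpace ℝ (Fin (n + 1))}
    (hv : ‖v‖ < B.r₀) {s : ℝ} (hs : 0 < s) (hs1 : s ≤ 1) :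
    B.psi χ (B.ofChart (s • v)) = B.ofChart (s • B.toChart (B.psi χ (B.ofChart v))) := by
  have hxsph : g (B.ofChart v) < B.sph := B.apply_ofChart_lt_sph hv
  have htx : B.toChart (B.ofChart v) = v := B.toChart_ofChart hv.le
  have hxs : B.ofChart (s • v) = B.θ (Real.log s, B.ofChart v) := by
    rw [← B.ofChart_smul_toChart hxsph hs hs1, htx]
  have hsv : ‖s • v‖ < B.r₀ := by
    rw [norm_smul, Real.norm_eq_abs, abs_of_pos hs]; exact lt_of_le_of_lt (mul_le_of_le_one_left (norm_nonneg v) hs1) hv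
  have hxs_hi : g (B.ofChart (s • v)) < B.hi := (B.apply_ofChart_lt_sph hsv).trans (B.sph_lt_L.trans B.L_lt_hi)
  have hx_hi : g (B.ofChart v) < B.hi := hxsph.trans (B.sph_lt_L.trans B.L_lt_hi)
  have hiff : B.ofChart (s • v) ∈ B.dom ↔ B.ofChart v ∈ B.dom := by
    rw [hxs] at hxs_hi ⊢; exact B.θ_mem_dom_iff hx_hi hxs_hi
  by_cases hxd : B.ofChart v ∈ B.dom
  · rw [psi_of_mem χ (hiff.2 hxd), psi_of_mem χ hxd]
    exact conj_ofChart_smul hχ hv hxd hs hs1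
  · rw [psi_of_not_mem χ (fun h => hxd (hiff.1 h)), psi_of_not_mem χ hxd, htx]

variable (B)

/-- **The chart expression of `psi` near `p₀`**: `v ↦ toChart (psi χ (ofChart v))`. [cite: GriffithsHB1964Handlebody, §§3–6] -/
def coneFun (χ : (𝓡∂ (n + 1)).boundary W → (𝓡∂ (n + 1)).boundary W) (v : EuclideanSpace ℝ (Fin (n + 1))) :
    EuclideanSpace ℝ (Fin (n + 1)) :=
  B.toChart (B.psi χ (B.ofChart v))

/-- Unfolding `coneFun`. [folklore] -/
theorem coneFun_def (χ : (𝓡∂ (n + 1)).boundary W → (𝓡∂ (n + 1)).boundary W) (v : EuclideanSpace ℝ (Fin (n + 1))) :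
    B.coneFun χ v = B.toChart (B.psi χ (B.ofChart v)) := rfl

variable {B}

/-- `coneFun χ 0 = 0`. [folklore] -/
theorem coneFun_zero (χ : (𝓡∂ (n + 1)).boundary W → (𝓡∂ (n + 1)).boundary W) : B.coneFun χ 0 = 0 := by
  rw [coneFun_def, B.ofChart_zero, psi_p₀, B.toChart_p₀]

/-- **`coneFun` preserves the norm** (`psi` preserves the levels `g = g p₀ + ‖·‖²`). [folklore] -/
theorem norm_coneFun (hχ : ∀ y, χ y ∈ B.traces ↔ y ∈ B.traces) {v : EuclideanSpace ℝ (Fin (n + 1))}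
    (hv : ‖v‖ < B.r₀) : ‖B.coneFun χ v‖ = ‖v‖ := by
  have hx : g (B.ofChart v) < B.sph := B.apply_ofChart_lt_sph hv
  have h1 : ‖B.coneFun χ v‖ ^ 2 = ‖v‖ ^ 2 := by
    rw [coneFun_def, B.norm_toChart_sq (apply_psi_lt_sph hχ hx).le, apply_psi hχ, B.apply_ofChart hv.le]
    ring
  exact (pow_left_inj₀ (norm_nonneg _) (norm_nonneg _) two_ne_zero).1 h1

/-- **`coneFun` is homogeneous of degree one** for factors in `(0, 1]`. [cite: GriffithsHB1964Handlebody, §§3–6] -/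
theorem coneFun_smul (hχ : ∀ y, χ y ∈ B.traces ↔ y ∈ B.traces) {v : EuclideanSpace ℝ (Fin (n + 1))}
    (hv : ‖v‖ < B.r₀) {s : ℝ} (hs : 0 < s) (hs1 : s ≤ 1) :
    B.coneFun χ (s • v) = s • B.coneFun χ v := by
  rw [coneFun_def, psi_ofChart_smul hχ hv hs hs1, B.toChart_ofChart, coneFun_def]
  rw [norm_smul, Real.norm_eq_abs, abs_of_pos hs, ← coneFun_def, norm_coneFun hχ hv]
  exact (mul_le_of_le_one_left (norm_nonneg v) hs1).trans hv.le

/-- **`coneFun χ'` inverts `coneFun χ` when `χ' ∘ χ = id`** (on the open chart ball). [folklore] -/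
theorem coneFun_coneFun (h : LeftInverse χ' χ) (hχ : ∀ y, χ y ∈ B.traces ↔ y ∈ B.traces)
    {v : EuclideanSpace ℝ (Fin (n + 1))} (hv : ‖v‖ < B.r₀) : B.coneFun χ' (B.coneFun χ v) = v := by
  rw [coneFun_def, coneFun_def, B.ofChart_toChart_of_apply_le (apply_psi_lt_sph hχ (B.apply_ofChart_lt_sph hv)).le,
    psi_psi_of_leftInverse h hχ, B.toChart_ofChart hv.le]

omit [Nonempty (BoundaryManifold.boundaryData n W).carrier] in
/-- **`ofChart` is smooth on the open chart ball.** [folklore] -/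
theorem contMDiffAt_ofChart {v : EuclideanSpace ℝ (Fin (n + 1))} (hv : ‖v‖ < B.r₀) :
    ContMDiffAt 𝓘(ℝ, EuclideanSpace ℝ (Fin (n + 1))) (𝓡∂ (n + 1)) ∞ B.ofChart v := by
  have h1 : ContMDiffOn 𝓘(ℝ, EuclideanSpace ℝ (Fin (n + 1))) (𝓡∂ (n + 1)) ∞ (B.φ.extend (𝓡∂ (n + 1))).symm
      (B.φ.extend (𝓡∂ (n + 1))).target := by
    rw [OpenPartialHomeomorph.extend_target']; exact contMDiffOn_extend_symm B.φ_mem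
  have hball : ball B.u₀ B.r₀ ⊆ (B.φ.extend (𝓡∂ (n + 1))).target := ball_subset_closedBall.trans B.closedBall_subset
  have hmem : B.u₀ + v ∈ ball B.u₀ B.r₀ := by rw [mem_ball, dist_eq_norm, add_sub_cancel_left]; exact hv
  have h2 : ContMDiffAt 𝓘(ℝ, EuclideanSpace ℝ (Fin (n + 1))) (𝓡∂ (n + 1)) ∞ (B.φ.extend (𝓡∂ (n + 1))).symm (B.u₀ + v) :=
    (h1 _ (hball hmem)).contMDiffAt (mem_of_superset (isOpen_ball.mem_nhds hmem) hball)
  exact h2.comp v ((contMDiffAt_const (c := B.u₀)).add contMDiffAt_id)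

omit [Nonempty (BoundaryManifold.boundaryData n W).carrier] in
/-- **`toChart` is smooth on the chart domain.** [folklore] -/
theorem contMDiffAt_toChart {x : W} (hx : x ∈ B.φ.source) :
    ContMDiffAt (𝓡∂ (n + 1)) 𝓘(ℝ, EuclideanSpace ℝ (Fin (n + 1))) ∞ B.toChart x :=
  (B.φ.contMDiffAt_extend B.φ_mem hx).sub contMDiffAt_const

/-- **`coneFun` of a smooth `χ`, the identity off a compact `K ⊆ ∂W ∩ basin` and preserving the
traces, is smooth on the punctured open chart ball.** [cite: GriffithsHB1964Handlebody, §§3–6] -/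
theorem contMDiffAt_coneFun (hχs : ContMDiff (𝓡 n) (𝓡 n) ∞ χ) (hχ : ∀ y, χ y ∈ B.traces ↔ y ∈ B.traces)
    {K : Set ((𝓡∂ (n + 1)).boundary W)} (hK : IsCompact K) (hKb : ∀ y ∈ K, (y : W) ∈ B.basin)
    (hχK : ∀ y, y ∉ K → χ y = y) {v : EuclideanSpace ℝ (Fin (n + 1))} (hv0 : v ≠ 0) (hv : ‖v‖ < B.r₀) :
    ContMDiffAt 𝓘(ℝ, EuclideanSpace ℝ (Fin (n + 1))) 𝓘(ℝ, EuclideanSpace ℝ (Fin (n + 1))) ∞ (B.coneFun χ) v := by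
  have hx : g (B.ofChart v) < B.sph := B.apply_ofChart_lt_sph hv
  have hxp : B.ofChart v ≠ B.p₀ := fun h => by
    have h1 : B.toChart (B.ofChart v) = 0 := by rw [h, B.toChart_p₀]
    rw [B.toChart_ofChart hv.le] at h1
    exact hv0 h1
  have hpsi := contMDiffAt_psi hχs hχ hK hKb hχK B.sph_mem_Ioo.2 hx hxp
  have h3 := B.contMDiffAt_toChart (B.mem_source_of_apply_le (apply_psi_lt_sph hχ hx).le)
  exact h3.comp v (hpsi.comp v (contMDiffAt_ofChart hv))

end BasinSetting

end Literature.Topology.FourManifolds
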